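import Summits.PneNP.PneNP.Theorems.ExpanderLinearGeneratorsNoPolyBoundedProofSystemBarriers
import Summits.PneNP.PneNP.Theorems.ExpanderLinearGeneratorsNoPolyBoundedProofSystemLadder
import Literature.Barriers.PneNP.RelativizationSparseTallyCoNP
import Literature.Barriers.PneNP.BoundedRelativizationProofs

/-!
# Route ExpanderLinearGenerators — the target `NoPolyBoundedProofSystem` over restricted oracle classes (`PSPACE`, `TALLY`)

Helper file for item `stmt-PneNP-0097` (the rank-0 target
`Summit.PneNP.PneNP.Theses.ExpanderLinearGenerators.NoPolyBoundedProofSystem :=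
 ¬ HasPolyBoundedProofSystem TAUT`, `NP ≠ coNP` over the tree's classes by
`noPolyBoundedProofSystem_iff_NP_ne_coNP`). The companion file
`ExpanderLinearGeneratorsNoPolyBoundedProofSystemBarriers.lean` records that the oracle family
`O ↦ NP^O ≠ coNP^O` of the target relativizes in neither direction (Baker–Gill–Solovay's recursive
`A` with `NP^A = coNP^A`; Wilson's `C` with `NP^C ≠ coNP^C`). This file locates the collapse half
inside restricted oracle classes (`CRelativizes`, `Literature/Barriers/PneNP/BoundedRelativization.lean`):
it is already carried by an oracle in `PSPACE` (bounded relativization after Hirahara–Lu–Ren, from the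
tree theorem `BoundedRelativization_holds : ∃ A ∈ PSPACE, P^A = NP^A`), but by NO tally oracle unless
the target is false — Long–Selman's tally theorem for `NP` versus `coNP` (tree theorem
`Literature.Barriers.PneNP.NP_eq_coNP_iff_cRelativizes_tally`, proved in
`Literature/Barriers/PneNP/RelativizationSparseTallyCoNP.lean`):

* `exists_mem_PSPACE_NPRel_eq_coNPRel`, `not_cRelativizes_PSPACE_NPRel_ne_coNPRel` — some
  `A ∈ PSPACE` has `NP^A = coNP^A`, so the target is not even `PSPACE`-relativizing (nor
  `𝒞`-relativizing for any `𝒞 ⊇ PSPACE`);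
* `noPolyBoundedProofSystem_iff_exists_tally` — the target holds iff SOME TALLY oracle `T ⊆ 0*`
  has `NP^T ≠ coNP^T`: a relativized separation of `NP` from `coNP` by a tally oracle is not a
  barrier-side curiosity but a proof of the target, and conversely;
* `not_noPolyBoundedProofSystem_iff_cRelativizes_tally` — the negation of the target is
  tally-oracle-independent (Egidy's terminology);
* `noPolyBoundedProofSystem_of_cRelativizes_tally` — the separation holding at every tally oracle
  gives the target (instance `T = ∅`);
* `noPolyBoundedProofSystem_iff_exists_tally_not_subset` — the separation shape: the target holds
  iff some tally `T` has `coNP^T ⊄ NP^T` (with the tree theorem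
  `noPolyBoundedProofSystem_iff_not_coNP_subset_NP` of the Ladder file);
* `noPolyBoundedProofSystem_tally_dichotomy` — under the negation every tally world collapses;
  under the target some tally world separates while the Baker–Gill–Solovay world collapses.

What is NOT here (not known): whether the target forces `NP^T ≠ coNP^T` at EVERY tally `T`.

Sources: T. J. Long, A. L. Selman, J. ACM 33 (1986) 618–627 (tally theorem); F. Egidy,
arXiv:2602.02294 (2026), §3 Thm. 6 (second item); S. Hirahara, Z. Lu, H. Ren, *Bounded relativization*,
CCC 2023, §1.1; S. Homer, A. L. Selman, *Computability and Complexity Theory* (2011), Thm. 7.18;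
S. A. Cook, R. A. Reckhow, JSL 44 (1979), Prop. 1.1.
-/

set_option linter.dupNamespace false -- `Summit.PneNP.PneNP.…`: summit = sub-problem name (D-0017 single-conjunct layout)

namespace Summit.PneNP.PneNP.Theorems

open Literature.Computability.Complexity Literature.Computability.MetaComplexity
open Literature.Barriers.PneNP
open Summit.PneNP.PneNP.Theses.ExpanderLinearGenerators

/-! ### `PSPACE`-bounded relativization -/

/-- **A collapsing world inside `PSPACE`**: some `A ∈ PSPACE` has `NP^A = coNP^A` — the tree's
`PSPACE`-complete oracle with `P^A = NP^A` (`BoundedRelativization_holds`, Homer–Selman Thm. 7.18)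
and the complement closure of `P^A` (`NPRel_eq_coNPRel_of_PRel_eq_NPRel`).
[cite: HomerSelman2011, Thm. 7.18] [cite: HiraharaLuRen2023, §1.1 (p. 3)] -/
theorem exists_mem_PSPACE_NPRel_eq_coNPRel :
    ∃ A : Language Bool, A ∈ PSPACE ∧ NPRel (Oracle.ofLanguage A) = coNPRel (Oracle.ofLanguage A) := by
  obtain ⟨A, hA, hPNP⟩ := BoundedRelativization_holds
  exact ⟨A, hA, NPRel_eq_coNPRel_of_PRel_eq_NPRel hPNP⟩

/-- **The target is not `PSPACE`-relativizing**: `O ↦ NP^O ≠ coNP^O` fails at an oracle of `PSPACE`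
(a stronger no-go than `not_relativizes_NPRel_ne_coNPRel`, by `not_relativizes_of_not_cRelativizes`).
[cite: HiraharaLuRen2023, §1.1 (p. 3)] -/
theorem not_cRelativizes_PSPACE_NPRel_ne_coNPRel :
    ¬ CRelativizes PSPACE fun O => NPRel O ≠ coNPRel O := by
  obtain ⟨A, hA, hEq⟩ := exists_mem_PSPACE_NPRel_eq_coNPRel
  exact fun h => h A hA hEq

/-- Hence not `𝒞`-relativizing for any oracle class `𝒞 ⊇ PSPACE`. [cite: HiraharaLuRen2023, §1.1 (p. 3)] -/
theorem not_cRelativizes_NPRel_ne_coNPRel_of_PSPACE_subset {𝒞 : Set (Language Bool)}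
    (h𝒞 : PSPACE ⊆ 𝒞) : ¬ CRelativizes 𝒞 fun O => NPRel O ≠ coNPRel O :=
  fun h => not_cRelativizes_PSPACE_NPRel_ne_coNPRel (h.anti h𝒞)

/-! ### Tally oracles (Long–Selman) -/

/-- **The target over tally oracles** (Long–Selman): `NoPolyBoundedProofSystem` holds iff some tally
oracle `T` separates `NP^T` from `coNP^T`. [cite: LongSelman1986, main theorem (tally form)] [cite: Egidy2026, §3 Thm. 6 (second item)] -/
theorem noPolyBoundedProofSystem_iff_exists_tally :
    NoPolyBoundedProofSystem ↔
      ∃ T : Language Bool, IsTally T ∧ NPRel (Oracle.ofLanguage T) ≠ coNPRel (Oracle.ofLanguage T) := by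
  rw [noPolyBoundedProofSystem_iff_NP_ne_coNP]
  exact NP_ne_coNP_iff_exists_tally

/-- The target is exactly the failure of `O ↦ NP^O = coNP^O` to be TALLY-relativizing.
[cite: LongSelman1986, main theorem (tally form)] [cite: Egidy2026, §3 Thm. 6 (second item)] -/
theorem noPolyBoundedProofSystem_iff_not_cRelativizes_tally :
    NoPolyBoundedProofSystem ↔ ¬ CRelativizes {T | IsTally T} fun O => NPRel O = coNPRel O := by
  rw [noPolyBoundedProofSystem_iff_NP_ne_coNP]
  exact tally_not_cRelativizes_NP_eq_coNP_iff.symm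

/-- The NEGATION of the target is tally-oracle-independent: `¬ NoPolyBoundedProofSystem` (i.e.
`NP = coNP`) holds iff it holds relative to every tally oracle. [cite: Egidy2026, §3 Thm. 6 (second item)] -/
theorem not_noPolyBoundedProofSystem_iff_cRelativizes_tally :
    ¬ NoPolyBoundedProofSystem ↔ CRelativizes {T | IsTally T} fun O => NPRel O = coNPRel O := by
  rw [noPolyBoundedProofSystem_iff_not_cRelativizes_tally, not_not]

/-- If the separation `NP^T ≠ coNP^T` holds at EVERY tally oracle then the target holds (the tally
oracle `∅`). [cite: Egidy2026, §3 (tally-oracle-independent statements)] -/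
theorem noPolyBoundedProofSystem_of_cRelativizes_tally
    (h : CRelativizes {T | IsTally T} fun O => NPRel O ≠ coNPRel O) : NoPolyBoundedProofSystem :=
  noPolyBoundedProofSystem_iff_NP_ne_coNP.2 (NP_ne_coNP_of_cRelativizes_tally h)

/-- **The target in its separation shape over tally oracles**: it holds iff some tally `T` has
`coNP^T ⊄ NP^T` (`→`: otherwise `coNP^∅ ⊆ NP^∅`, i.e. `coNP ⊆ NP`, against the tree theorem
`noPolyBoundedProofSystem_iff_not_coNP_subset_NP`; `←`: under `NP = coNP` every tally `T` has
`coNP^T ⊆ NP^T`, `LongSelman.coNPRel_subset_NPRel_of_isTally`). So a proof of the target is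
EQUIVALENT to exhibiting a tally oracle `T` and a language of `coNP^T` outside `NP^T`.
[cite: LongSelman1986, main theorem (tally form)] [cite: Egidy2026, §3 Thm. 6 (second item)] -/
theorem noPolyBoundedProofSystem_iff_exists_tally_not_subset :
    NoPolyBoundedProofSystem ↔
      ∃ T : Language Bool, IsTally T ∧ ¬ coNPRel (Oracle.ofLanguage T) ⊆ NPRel (Oracle.ofLanguage T) := by
  constructor
  · intro hX
    by_contra hnone
    have hall : ∀ T : Language Bool, IsTally T →
        coNPRel (Oracle.ofLanguage T) ⊆ NPRel (Oracle.ofLanguage T) :=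
      fun T hT => by_contra fun h => hnone ⟨T, hT, h⟩
    have h0 : coNPRel Oracle.empty ⊆ NPRel Oracle.empty := hall 0 isTally_zero
    rw [coNPRel_empty, NPRel_empty] at h0
    exact noPolyBoundedProofSystem_iff_not_coNP_subset_NP.1 hX h0
  · rintro ⟨T, hT, hnot⟩
    rw [noPolyBoundedProofSystem_iff_NP_ne_coNP]
    exact fun hNC => hnot (LongSelman.coNPRel_subset_NPRel_of_isTally hNC hT)

/-- Under the NEGATION of the target every tally oracle collapses `NP^T = coNP^T`; contrapositively, a
single tally world with `NP^T ≠ coNP^T` settles the target. Compare the Baker–Gill–Solovay world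
`A` of `exists_computable_oracle_NPRel_eq_coNPRel` (`NP^A = coNP^A` unconditionally): if the target
holds, some tally oracle separates while `A` collapses, so relativized `NP` versus `coNP` is
oracle-DEPENDENT already inside `TALLY ∪ {A}`. [cite: LongSelman1986, main theorem (tally form)] -/
theorem noPolyBoundedProofSystem_tally_dichotomy :
    (¬ NoPolyBoundedProofSystem →
        ∀ T : Language Bool, IsTally T → NPRel (Oracle.ofLanguage T) = coNPRel (Oracle.ofLanguage T)) ∧
      (NoPolyBoundedProofSystem →
        (∃ T : Language Bool, IsTally T ∧ NPRel (Oracle.ofLanguage T) ≠ coNPRel (Oracle.ofLanguage T)) ∧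
          ∃ A : Language Bool, NPRel (Oracle.ofLanguage A) = coNPRel (Oracle.ofLanguage A)) := by
  refine ⟨fun h T hT => not_noPolyBoundedProofSystem_iff_cRelativizes_tally.1 h T hT, fun hX => ⟨?_, ?_⟩⟩
  · exact noPolyBoundedProofSystem_iff_exists_tally.1 hX
  · obtain ⟨A, -, hA⟩ := exists_computable_oracle_NPRel_eq_coNPRel
    exact ⟨A, hA⟩

end Summit.PneNP.PneNP.Theorems
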